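import Literature.Barriers.HodgeConjecture.KaehlerCounterexamplesJTorus
import Literature.Geometry.Kaehler.ComplexTorusZuckerLattice
import HarnessLib

/-!
# Barrier fact `Zucker1977_kaehlerTorus_noAnalyticCycles` on the explicit general `J`-torus `T₀ = ℂ²/L₀`

`KaehlerCounterexamplesJTorus.lean` assembles the barrier fact
`Literature.Barriers.HodgeConjecture.Zucker1977_kaehlerTorus_noAnalyticCycles` (Zucker (1977),
Appendix B, Theorem p. 208 for `n = 1`: a compact Kähler surface with a non-zero integral
`(1,1)`-class and no analytic curve) from two leaves, for ANY `J`-lattice `Φ`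
(`Zucker1977_kaehlerTorus_noAnalyticCycles_of_leaves`): (1) de Rham's theorem with complex
coefficients on `ℂ²` (the named fact `Literature.NumberTheory.Transcendental.exists_complexDeRhamIsoFamily (Fin 2 → ℂ)`,
which the fact conversely implies) and (2) the absence of analytic hypersurfaces on the torus
`ℂ²/Φ(ℤ⁴)`. Leaf (2) fails for special `J`-lattices (the square one of
`ComplexTorusZuckerJ.lean` is `E_i × E_i`) and holds, by Zucker's Theorem, for the general one.
This file pins leaf (2) to ONE explicit torus: the skew `J`-lattice
`L₀ = ℤv₁ ⊕ ℤv₂ ⊕ ℤJv₁ ⊕ ℤJv₂`, `v₁ = (1, 1)`, `v₂ = (√2, √3)` of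
`Literature/Geometry/Kaehler/ComplexTorusZuckerLattice.lean` (`Zucker.skewPeriodCLE`, a
`J`-lattice by `Zucker.skewPeriodCLE_mulVec`), for which Zucker's genericity Proposition
(p. 207: the integral `(1,1)`-classes have rank two, so that `dz ∧ dz̄`, `dw ∧ dw̄` and hence the
flat Kähler form have period zero over every integral `(1,1)`-bivector, `J_* = -1` on them, and
no complex line meets `L₀` in a lattice) is proved in the companion file
`Literature/Geometry/Kaehler/ComplexTorusZuckerPeriods.lean`.

* `Zucker1977_kaehlerTorus_noAnalyticCycles_of_skewLattice`: the fact follows from de Rham's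
  theorem on `ℂ²` and the statement that `T₀ = ComplexTorus Zucker.skewPeriodCLE` contains no
  analytic hypersurface.

What remains for the unconditional `_holds` (NOT here): leaf (1), de Rham's theorem; and leaf (2)
for `T₀` — by Zucker's argument, an analytic curve `Z ⊂ T₀` would carry a non-zero integral
`2`-homology class of type `(1,1)` over which the Kähler form integrates to the positive area of
`Z` (fundamental class / integration current of an analytic curve, or the periods of `dz`, `dw` on
its normalisation), contradicting the vanishing of those periods on `T₀`; the tree has no cycle
classes of analytic subvarieties yet.

## References

* S. Zucker, Compositio Math. 34 (1977) 199–209, Appendix B, Proposition p. 207, Theorem p. 208.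
  [Zucker1977]
* C. Voisin, IMRN 2002 no. 20, §1 ("If the torus is chosen general enough, it will not contain
  any analytic hypersurface"). [Voisin2002KaehlerCounterexample]
-/

noncomputable section

open scoped Manifold ContDiff Topology

namespace Literature.Barriers.HodgeConjecture

open Literature.NumberTheory.Transcendental Literature.Geometry.Kaehler

/-- **Zucker's barrier fact from the two leaves, on the explicit general `J`-torus
`T₀ = ℂ²/L₀`.** If (1) de Rham's theorem with complex coefficients holds for manifolds charted on
`ℂ²` and (2) the torus `T₀ = ComplexTorus Zucker.skewPeriodCLE` of the skew `J`-lattice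
`L₀ = ℤ(1,1) ⊕ ℤ(√2,√3) ⊕ ℤ(i,-i) ⊕ ℤ(i√2,-i√3)` contains no analytic hypersurface (Zucker's
Theorem p. 208 for this lattice; Voisin: "if the torus is chosen general enough, it will not
contain any analytic hypersurface"), then `Zucker1977_kaehlerTorus_noAnalyticCycles` holds: the
witness is `T₀` with the integral anti-`J`-invariant class of `KaehlerCounterexamplesJTorus`.
[cite: Zucker1977, Appendix B Theorem p. 208] [cite: Voisin2002KaehlerCounterexample, §1] -/
theorem Zucker1977_kaehlerTorus_noAnalyticCycles_of_skewLattice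
    (h₁ : exists_complexDeRhamIsoFamily (Fin 2 → ℂ))
    (h₂ : ∀ Z : Set (ComplexTorus Zucker.skewPeriodCLE),
      ¬ IsAnalyticHypersurface (E := Fin 2 → ℂ) Z) :
    Zucker1977_kaehlerTorus_noAnalyticCycles :=
  Zucker1977_kaehlerTorus_noAnalyticCycles_of_leaves Zucker.skewPeriodCLE Zucker.squareMatrix
    Zucker.skewPeriodCLE_mulVec h₁ h₂

end Literature.Barriers.HodgeConjecture

end
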